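import Summits.HodgeConjecture.HodgeConjecture.Theses.NodalThetaWeil
import Literature.AlgebraicGeometry.HodgeTheory.SupportedHodgeClassesAlgebraic
import Literature.AlgebraicGeometry.HodgeTheory.ComplexOrientationFamily
import Literature.AlgebraicTopology.SingularHomology.GysinMapSupportProofs

/-!
# Birth skeleton (BC3) of the crux `NodeDualClassesAlgebraic` (stmt-HodgeConjecture-7745),
# route `NodalThetaWeil` — line `birth`: "Deligne descent to the resolved divisor, then HC(2,2) in Gysin form"

The crux (rank 3, the novelty audit's missing conjunct of the route): on an abelian SIXFOLD of Weil
type `(A, φ ≫ φ = -d·𝟙)`, a Weil class `c` — rational, of Hodge type `(3,3)`, in the Weil plane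
`E₊ ⊕ E₋ ⊂ H⁶(A(ℂ); ℂ)` — that IS supported on a proper Zariski-closed subset
(`c ∈ supportedClasses A.X 6 1 = N¹H⁶`) is algebraic (`c ∈ algebraicClasses A.X 3 = N³H⁶`).
The route file's own reading of it (item docstring): "By DeligneHodgeIII1974 Cor. 8.2.8 +
semisimplicity the class is the Gysin image of a Hodge class `B̄ ∈ H^{2,2}(D̃)` on a resolution of
the supporting divisor, and […] the statement is HC for those classes" (Thomas 2005 §3 Lemmas 3–4,
Schoen 1985).  This birth skeleton types exactly that seam, on the tree's carriers
(`complexGysin complexOrientationFamily`, `supportedClasses`, `algebraicClasses`):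

  STUB 1 `stub_weilSupportedClassDescent` — DELIGNE–HIRONAKA–VOISIN DESCENT, specialised to the
    Weil sixfold: modulo algebraic classes, a supported Weil class is a `ℂ`-combination of Gysin
    images `g_* b` of RATIONAL `(2,2)`-CLASSES `b` on smooth projective FIVEFOLDS `g : Y ⟶ A`
    (the resolved components of the supporting divisor; the lower-dimensional components of the
    support contribute Gysin images of `(1,1)`- and `(0,0)`-classes, algebraic by Lefschetz `(1,1)`,
    whence the `⊔ algebraicClasses A.X 3`).  KNOWN (Deligne 8.2.8 + polarisability + Hironaka) and
    CLOSABLE NOW on this tree: every ingredient is a proved theorem here (see the stub docstring) —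
    the line's cheap first stub, S/M-sized bookkeeping over `m_j ∈ {3,4,5}`.
  STUB 2 `stub_liftedTwoTwoClassesAlgebraic` — THE HEART (open): the Gysin image in `H⁶(A)` of a
    rational `(2,2)`-class on a smooth projective fivefold mapping to a Weil-type abelian sixfold is
    algebraic — "HC one dimension down, in Gysin form" (it asks `g_* b ∈ N³H⁶(A)`, NOT `b ∈ N²H⁴(Y)`).
    For NODAL theta divisors this is Schoen's problem for the node-dual classes `⟨Aᵢ − Bᵢ⟩^*`
    (Thomas 2005 eq. (d)); the route's foreseen attack is IsotropicThreefolds + PrimitiveProjection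
    (Lieberman `B(A)`), both untypable today (no nodal divisors / Lefschetz operator on `complexBetti`).
    HC-safe: implied by `HodgeConjecture` (PROVED below, `liftedTwoTwoClassesAlgebraic_of_hodgeConjecture`:
    HC on `Y`, then Gysin images of algebraic classes are algebraic — tree theorem
    `map_complexGysin_algebraicClasses_le` with its two facts discharged).

and the crux follows (`NodeDualClassesAlgebraic_of`, kernel-checked, no `sorry`): STUB 1 puts `c`
in `(⨆_{Y,g} g_*(span{rational (2,2)})) ⊔ N³H⁶`, STUB 2 bounds every summand of the `⨆` by `N³H⁶`
(`iSup_le` / `Submodule.span_le`), so `c ∈ N³H⁶`.  Hardest stub: STUB 2 (it carries the whole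
open content, as the route intends — "the whole difficulty of this route at n = 3 sits in
NodeDualClassesAlgebraic", item 7747's docstring); STUB 1 is where the supported-ness hypothesis
and the Weil datum are consumed.  Neither stub is the crux or the summit in costume: STUB 1 does
not conclude algebraicity, STUB 2 has no support/Weil-plane hypothesis and quantifies over classes
that need not be Weil classes; the BC3 probes `stub → crux`, `stub → HodgeConjecture` by
`first | exact? | simpa [S] | (unfold S; simpa) | aesop` FAIL for both (see `Lines/birth.md`).

Layout: `Registered.stub_*` — name-keyed `abbrev`s of the two stub statements (the skeleton audit
admits a hypothesis of `NodeDualClassesAlgebraic_of` iff the head constant of its type carries a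
registered stub's short name; `@[stub]` tags are gate-reserved); the two `theorem stub_* := by sorry`
(the ONLY `sorry`s of the file, signatures verbatim = the registered signatures); the composition;
proved sanity (`liftedTwoTwoClassesAlgebraic_of_hodgeConjecture`, and HC ⇒ crux as an `example` so
that the composition is the only theorem concluding the crux by name).

Disproof used: none on file — `Cruxes/NodeDualClassesAlgebraic/` had no `Disproof.lean`, no
`_false_without_` theorem and no landed `Negative/` lemma at registration (`ledger crux ls
stmt-HodgeConjecture-7745`: no workfiles, 2026-08-17); `ledger negatives --problem HodgeConjecture`
(3 entries: MilnorK symbol lift, Fermat K3 multisets, E-line matrices) — none bears on supported /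
Gysin / Weil classes.  The only landed theorem mentioning the crux is the kill-transfer
`Theorems/HodgeAbelianVarieties/Negative/KillTransfer` (`¬ crux → ¬ HodgeAbelianVarieties`), imported
by the probes so that `exact?` sees it.
-/

set_option linter.dupNamespace false

noncomputable section

open CategoryTheory AlgebraicGeometry
open Literature.AlgebraicGeometry Literature.AlgebraicGeometry.Motives Literature.AlgebraicGeometry.HodgeTheory
open Literature.AlgebraicTopology.SingularHomology
open Summit.HodgeConjecture.HodgeConjecture.Theses.NodalThetaWeil

namespace Summit.HodgeConjecture.HodgeConjecture.Cruxes.NodeDualClassesAlgebraic.Birth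

/-! ## §1 Name-keyed statements of the stubs

The skeleton audit (`#h21_check_skeleton`) admits a `Prop` hypothesis of the composition iff the
head constant of its type is a registered obligation or carries the short name of a declared stub;
these `abbrev`s give the two stub statements such head constants (same text as the `theorem
stub_*` signatures of §2, which are what `ledger skeleton check` registers). -/

namespace Registered

/-- Statement of STUB 1 (`stub_weilSupportedClassDescent`): Deligne–Hironaka–Voisin descent of a
supported Weil class on a Weil-type abelian sixfold to rational `(2,2)`-classes on smooth projective
fivefolds, modulo algebraic classes. [cite: DeligneHodgeIII1974, Cor. 8.2.8]
[cite: Voisin2025, Cor. 2.12] [cite: Thomas2005Nodes, §3 Lemmas 3–4] -/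
abbrev stub_weilSupportedClassDescent : Prop :=
  ∀ (d : ℕ), 0 < d → ∀ (A : AbelianVariety ℂ) (φ : A ⟶ A), A.dim = 2 * 3 →
    ∀ (hX : IsSmoothProjective (2 * 3) A.X), φ ≫ φ = -(d • 𝟙 A) →
    ∀ c : singularCohomology ℂ ℂ (ComplexPoints A.X) (2 * 3), IsRationalClass c →
    IsOfHodgeType (2 * 3) A.X (2 * 3) 3 3 c →
    (∃ c₁ c₂ : singularCohomology ℂ ℂ (ComplexPoints A.X) (2 * 3), c = c₁ + c₂ ∧
      (∀ x y : ℕ, singularCohomology.map ℂ ℂ (AlgPoints.mapContinuous (L := ℂ) (x • 𝟙 A + y • φ).hom.hom.hom) (2 * 3) c₁ =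
        ((x : ℂ) + (y : ℂ) * Complex.I * (Real.sqrt d : ℂ)) ^ (2 * 3) • c₁) ∧
      (∀ x y : ℕ, singularCohomology.map ℂ ℂ (AlgPoints.mapContinuous (L := ℂ) (x • 𝟙 A + y • φ).hom.hom.hom) (2 * 3) c₂ =
        ((x : ℂ) - (y : ℂ) * Complex.I * (Real.sqrt d : ℂ)) ^ (2 * 3) • c₂)) →
    c ∈ supportedClasses A.X (2 * 3) 1 →
    c ∈ (⨆ (Y : SchemeOver ℂ) (hY : IsSmoothProjective 5 Y) (g : Y ⟶ A.X),
          (Submodule.span ℂ {b : complexBetti Y (2 * 2) |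
              IsRationalClass b ∧ IsOfHodgeType 5 Y (2 * 2) 2 2 b}).map
            (complexGysin complexOrientationFamily hY hX g
              (show 2 * 2 + 2 * (2 * 3) = 2 * 3 + 2 * 5 by norm_num))) ⊔
        algebraicClasses A.X 3

/-- Statement of STUB 2 (`stub_liftedTwoTwoClassesAlgebraic`): Gysin images in `H⁶(A)` of rational
`(2,2)`-classes on smooth projective fivefolds mapping to a Weil-type abelian sixfold are algebraic.
[cite: Thomas2005Nodes, §3 (Lemmas 3–4, eq. (d))] [cite: Schoen1985, Lemma 1.1] -/
abbrev stub_liftedTwoTwoClassesAlgebraic : Prop :=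
  ∀ (d : ℕ), 0 < d → ∀ (A : AbelianVariety ℂ) (φ : A ⟶ A), A.dim = 2 * 3 →
    ∀ (hX : IsSmoothProjective (2 * 3) A.X), φ ≫ φ = -(d • 𝟙 A) →
    ∀ (Y : SchemeOver ℂ) (hY : IsSmoothProjective 5 Y) (g : Y ⟶ A.X) (b : complexBetti Y (2 * 2)),
    IsRationalClass b → IsOfHodgeType 5 Y (2 * 2) 2 2 b →
    complexGysin complexOrientationFamily hY hX g
        (show 2 * 2 + 2 * (2 * 3) = 2 * 3 + 2 * 5 by norm_num) b ∈ algebraicClasses A.X 3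

end Registered

/-! ## §2 The two registered stubs (the ONLY `sorry`s of this file) -/

/-- STUB 1 — **descent of a supported Weil class to the resolved divisor** (KNOWN; closable now on
this tree, S/M).  For a Weil-type abelian sixfold `(A, φ ≫ φ = -d·𝟙)` and a rational `(3,3)`-class
`c` in the Weil plane lying in `N¹H⁶(A) = supportedClasses A.X 6 1`, `c` lies in
`(⨆_{Y, g} g_* span_ℂ {b ∈ H⁴(Y(ℂ); ℂ) rational of type (2,2)}) ⊔ algebraicClasses A.X 3`, the `⨆`
over smooth projective FIVEFOLDS `Y` and morphisms `g : Y ⟶ A` (Gysin `H⁴(Y) → H⁶(A)` relative to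
the complex orientation family).  Proof in print: `c` dies off a closed `Z ⊊ A` (all points of
codimension `≥ 1`); desingularise the components `Zⱼ` of `Z` (Hironaka: `gⱼ : Yⱼ ⟶ A` smooth
projective of dimension `mⱼ ≤ 5` onto `Zⱼ`); Deligne 8.2.8 gives `c ∈ Σⱼ im (gⱼ)_*`, and
polarisability (Voisin 2025 Cor. 2.12 / Voisin I Lemma 7.26) refines this, for the rational
`(3,3)`-class `c`, to `c = Σⱼ (gⱼ)_* bⱼ` with `bⱼ` rational of type `(mⱼ − 3, mⱼ − 3)`; the
`mⱼ = 5` summands are the first term, the `mⱼ = 4` (`bⱼ` a rational `(1,1)`-class, a divisor class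
by Lefschetz) and `mⱼ = 3` (`bⱼ ∈ H⁰ = N⁰H⁰`) summands are Gysin images of algebraic classes, hence in
`algebraicClasses A.X 3`.  ON THE TREE every ingredient is PROVED:
`Voisin2025_hodgeClass_lift_complexGysin.mem_iSup_map_of_restrictCompl_eq_zero` (fed by
`exists_support_of_mem_supportedClasses`, `exists_family_iUnion_range_eq_of_isClosed`) or directly
`mem_iSup_map_complexGysin_of_restrictCompl_eq_zero_of_ne_univ`, then
`map_complexGysin_algebraicClasses_le` and `supportedClasses_zero`, with the named facts discharged
by `Deligne1974_ker_restrictCompl_eq_iSup_range_complexGysin_holds`,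
`Voisin2025_hodgeClass_lift_complexGysin_holds`, `Resolution.Hironaka1964_projective_holds`,
`lefschetzOneOne_rational_holds`, `gysinMap_restrictCompl_eq_zero_of_field ℂ` and
`hasPoincareDuality_complexOrientationFamily` — what remains is the dependent-type bookkeeping
`mⱼ + e = 6`, `e ∈ {1,2,3}` (the Weil-plane hypothesis is not needed for this stub and may be
discarded by its prover).  Why it might fail: it does not (theorem in print and, modulo assembly,
in the tree); the only risk is a mismatch of degree conventions in `complexGysin`, excluded by the
elaboration of `liftedTwoTwoClassesAlgebraic_of_hodgeConjecture` below, which pushes `H⁴(Y)` to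
`H⁶(A)` through the same term. [cite: DeligneHodgeIII1974, Cor. 8.2.8]
[cite: Voisin2025, Cor. 2.12] [cite: Kollar2007, Thm. 3.27] [cite: VoisinHodgeI2002, Thm. 11.30]
[cite: Thomas2005Nodes, §3 Lemmas 3–4] -/
theorem stub_weilSupportedClassDescent :
  ∀ (d : ℕ), 0 < d → ∀ (A : AbelianVariety ℂ) (φ : A ⟶ A), A.dim = 2 * 3 →
    ∀ (hX : IsSmoothProjective (2 * 3) A.X), φ ≫ φ = -(d • 𝟙 A) →
    ∀ c : singularCohomology ℂ ℂ (ComplexPoints A.X) (2 * 3), IsRationalClass c →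
    IsOfHodgeType (2 * 3) A.X (2 * 3) 3 3 c →
    (∃ c₁ c₂ : singularCohomology ℂ ℂ (ComplexPoints A.X) (2 * 3), c = c₁ + c₂ ∧
      (∀ x y : ℕ, singularCohomology.map ℂ ℂ (AlgPoints.mapContinuous (L := ℂ) (x • 𝟙 A + y • φ).hom.hom.hom) (2 * 3) c₁ =
        ((x : ℂ) + (y : ℂ) * Complex.I * (Real.sqrt d : ℂ)) ^ (2 * 3) • c₁) ∧
      (∀ x y : ℕ, singularCohomology.map ℂ ℂ (AlgPoints.mapContinuous (L := ℂ) (x • 𝟙 A + y • φ).hom.hom.hom) (2 * 3) c₂ =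
        ((x : ℂ) - (y : ℂ) * Complex.I * (Real.sqrt d : ℂ)) ^ (2 * 3) • c₂)) →
    c ∈ supportedClasses A.X (2 * 3) 1 →
    c ∈ (⨆ (Y : SchemeOver ℂ) (hY : IsSmoothProjective 5 Y) (g : Y ⟶ A.X),
          (Submodule.span ℂ {b : complexBetti Y (2 * 2) |
              IsRationalClass b ∧ IsOfHodgeType 5 Y (2 * 2) 2 2 b}).map
            (complexGysin complexOrientationFamily hY hX g
              (show 2 * 2 + 2 * (2 * 3) = 2 * 3 + 2 * 5 by norm_num))) ⊔
        algebraicClasses A.X 3 := by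
  sorry

/-- STUB 2 — **THE HEART: the lifted `(2,2)`-classes push forward to algebraic classes** (OPEN;
HC one dimension down, in Gysin form).  For a Weil-type abelian sixfold `(A, φ ≫ φ = -d·𝟙)`, every
smooth projective fivefold `Y` with a morphism `g : Y ⟶ A`, and every rational `(2,2)`-class
`b ∈ H⁴(Y(ℂ); ℂ)`, the Gysin image `g_* b ∈ H⁶(A(ℂ); ℂ)` lies in `algebraicClasses A.X 3`.  In the
route this is the Hodge conjecture for the lifted classes `B̄ ∈ H^{2,2}(D̃⁵)` of resolved supporting
divisors (Thomas 2005 §3: for a NODAL `D ∈ |kΘ|` the new `(2,2)`-classes of `D̃` are the node-dual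
lattice `⟨Aᵢ − Bᵢ⟩^*` of relations among vanishing spheres, eq. (d) = Schoen 1985 Lemma 1.1), asked
only AFTER push-forward to `A` (weaker than `b ∈ algebraicClasses Y 2`: the part of `b` killed by
`g_*` is free, and on `A` the primitive decomposition and the `K`-action are available — the route's
foreseen split IsotropicThreefolds → PrimitiveProjection / Lieberman `B(A)`).  Why plausibly true:
it is implied by the Hodge conjecture (`liftedTwoTwoClassesAlgebraic_of_hodgeConjecture`, proved
below), so it is irrefutable short of `¬HC`; known when `b ∈ g^*H⁴(A)` on a general Weil sixfold
(`g_* g^* a = a ∪ [D]`, `B²(A) = ℚθ²`) and for `Y` dominated by products of curves / cellular.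
Why it might fail (as a LINE, not in truth): it is HC(2,2)-strength for fivefolds of general type
dominating theta divisors — "itself a hard unsolved problem" (Thomas 2005 §1; Schoen 1985) — and
one dimension down only Lefschetz `(1,1)` is available, so at `n = 3` no method exists yet; the
abelian structure survives only through `g`. Size XL. [cite: Thomas2005Nodes, §1 and §3 (Lemmas 3–4, eq. (d))]
[cite: Schoen1985, Lemma 1.1] [cite: Lieberman1968, Thm. B(A) for abelian varieties] -/
theorem stub_liftedTwoTwoClassesAlgebraic :
  ∀ (d : ℕ), 0 < d → ∀ (A : AbelianVariety ℂ) (φ : A ⟶ A), A.dim = 2 * 3 →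
    ∀ (hX : IsSmoothProjective (2 * 3) A.X), φ ≫ φ = -(d • 𝟙 A) →
    ∀ (Y : SchemeOver ℂ) (hY : IsSmoothProjective 5 Y) (g : Y ⟶ A.X) (b : complexBetti Y (2 * 2)),
    IsRationalClass b → IsOfHodgeType 5 Y (2 * 2) 2 2 b →
    complexGysin complexOrientationFamily hY hX g
        (show 2 * 2 + 2 * (2 * 3) = 2 * 3 + 2 * 5 by norm_num) b ∈ algebraicClasses A.X 3 := by
  sorry

/-! ## §3 The composition: STUB 1 → STUB 2 → the crux, by name (no `sorry` below this line) -/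

/-- **THE LINE'S COMPOSITION** (kernel-checked, no `sorry`): descent (STUB 1) and algebraicity of
the pushed-forward `(2,2)`-classes (STUB 2) imply the crux `NodeDualClassesAlgebraic`: STUB 1 puts
the supported Weil class `c` in `(⨆_{Y,g} g_* span{rational (2,2)}) ⊔ N³H⁶(A)`; by STUB 2 every
generator `g_* b` of every summand lies in the submodule `N³H⁶(A) = algebraicClasses A.X 3`, so the
whole `⨆` does (`iSup_le`, `Submodule.map_le_iff_le_comap`, `Submodule.span_le`), hence `c` does.
[cite: Thomas2005Nodes, §3 Lemmas 3–4] -/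
theorem NodeDualClassesAlgebraic_of (h₁ : Registered.stub_weilSupportedClassDescent)
    (h₂ : Registered.stub_liftedTwoTwoClassesAlgebraic) :
    Summit.HodgeConjecture.HodgeConjecture.Theses.NodalThetaWeil.NodeDualClassesAlgebraic := by
  intro d hd A φ hdim hX hφ c hr hh hw hs
  -- STUB 1: modulo algebraic classes, `c` is a combination of Gysin images of rational (2,2)-classes
  -- on smooth projective fivefolds mapping to `A`
  have hmem := h₁ d hd A φ hdim hX hφ c hr hh hw hs
  -- STUB 2: every such Gysin image is algebraic, hence so is the span of all of them
  have hle : (⨆ (Y : SchemeOver ℂ) (hY : IsSmoothProjective 5 Y) (g : Y ⟶ A.X),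
      (Submodule.span ℂ {b : complexBetti Y (2 * 2) |
          IsRationalClass b ∧ IsOfHodgeType 5 Y (2 * 2) 2 2 b}).map
        (complexGysin complexOrientationFamily hY hX g
          (show 2 * 2 + 2 * (2 * 3) = 2 * 3 + 2 * 5 by norm_num))) ≤ algebraicClasses A.X 3 := by
    refine iSup_le fun Y ↦ iSup_le fun hY ↦ iSup_le fun g ↦ ?_
    rw [Submodule.map_le_iff_le_comap, Submodule.span_le]
    rintro b ⟨hb, hb'⟩
    rw [SetLike.mem_coe, Submodule.mem_comap]
    exact h₂ d hd A φ hdim hX hφ Y hY g b hb hb'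
  exact (sup_le hle le_rfl) hmem

/-- Wiring check: the registered stubs (§2) feed the composition as stated — definitional unfolding
of the `Registered` abbrevs only.  An `example`, so that `NodeDualClassesAlgebraic_of` stays the only
theorem of the file concluding the crux by name. -/
example : Summit.HodgeConjecture.HodgeConjecture.Theses.NodalThetaWeil.NodeDualClassesAlgebraic :=
  NodeDualClassesAlgebraic_of stub_weilSupportedClassDescent stub_liftedTwoTwoClassesAlgebraic

/-! ## §4 Proved sanity: HC-safety of the heart and of the crux (no costume, no `sorry`) -/

/-- **The Hodge conjecture implies the heart (PROVED)**: under `HodgeConjecture`, a rational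
`(2,2)`-class `b` on the smooth projective fivefold `Y` is algebraic on `Y` (`HodgeConjectureFor 5 Y`),
and Gysin images of algebraic classes are algebraic with the codimension shift `2 + 1 = 3` — the
tree theorem `map_complexGysin_algebraicClasses_le`, its two named facts discharged by the tree
theorems `gysinMap_restrictCompl_eq_zero_of_field ℂ` (Fulton, App. B Ex. 5) and
`hasPoincareDuality_complexOrientationFamily`.  So STUB 2 is irrefutable short of `¬HC`: the risk
of the line is hardness, not falsity. [cite: Deligne2000, §1] [cite: FultonYoungTableaux1997, Appendix B §B.2 Exercise 5] -/
theorem liftedTwoTwoClassesAlgebraic_of_hodgeConjecture (hHC : _root_.HodgeConjecture) :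
    Registered.stub_liftedTwoTwoClassesAlgebraic := by
  intro d hd A φ hdim hX hφ Y hY g b hb hb'
  have hbY : b ∈ algebraicClasses Y 2 := (hHC hY).2 2 b hb hb'
  exact map_complexGysin_algebraicClasses_le (gysinMap_restrictCompl_eq_zero_of_field ℂ)
    complexOrientationFamily hasPoincareDuality_complexOrientationFamily hY hX g
    (d := 2) (e := 1) (show 5 + 1 = 2 * 3 by norm_num) ⟨b, hbY, rfl⟩

/-- **The Hodge conjecture implies the crux (PROVED, one line)** — HC-safety of the crux itself, as
the refuters recorded (it is weaker than the route target `WeilSixfolds`: drop the `N¹` hypothesis).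
An `example`, so that the composition stays the only theorem concluding the crux by name. -/
example (hHC : _root_.HodgeConjecture) :
    Summit.HodgeConjecture.HodgeConjecture.Theses.NodalThetaWeil.NodeDualClassesAlgebraic :=
  fun _d _hd _A _φ _hdim hX _hφ c hr hh _hw _hs ↦ (hHC hX).2 3 c hr hh

/-- **The route target implies the crux (PROVED, one line)**: `WeilSixfolds → NodeDualClassesAlgebraic`
(the crux is the supported case of the target). An `example` for the same reason. -/
example (hW : WeilSixfolds) :
    Summit.HodgeConjecture.HodgeConjecture.Theses.NodalThetaWeil.NodeDualClassesAlgebraic :=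
  fun d hd A φ hdim hX hφ c hr hh hw _hs ↦ hW d hd A φ hdim hX hφ c hr hh hw

end Summit.HodgeConjecture.HodgeConjecture.Cruxes.NodeDualClassesAlgebraic.Birth

end
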